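import Summits.Ventures.Crystal3D.Inequalities.ExposedAreaDeficit
import Summits.Ventures.Crystal3D.LocalLP.ContactBridge
import Mathlib.Analysis.Real.Pi.Bounds
import HarnessLib

/-!
# Exposed area ⇒ contact bound, in the vocabulary of `StickySpheres/ContactGraph.lean`

Venture `Crystal3D` (cell `pub-crystal3d`, seat p2), continuation of `Inequalities/ExposedAreaDeficit.lean`
(the LP summation and the certified Lévy-dilation table `fLevy2` at truncation radius `r̂ = 2`) and of
`LocalLP/ContactBridge.lean` (p3: `IsUnitPacking`, `coordination`, `numContacts`, the handshake identity and
`coordination_le_twelve` from the tree's kissing-number theorem).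

HONEST FRAMING. The theorems below say: for a packing `x` of `N` unit-diameter balls in `ℝ³`, IF each ball `i`
carries a real number `e i` ("exposed area of its radius-`2·(diameter)` sphere", see `HOME/ineq/DECOMPOSITION.md`
§3: EXP + DIL + Lévy's spherical isoperimetric inequality give `e i ≤ fLevy2 (coordination x i)`, and the
kissing saturation gives `e i = 0` at coordination `12`) and IF the total `∑ e i` is at least `s · N^{2/3}` (the
isoperimetric inequality of `ℝ³` plus a cell-volume bound give `s = 4π · dv^{-2/3}`), THEN
`numContacts x ≤ 6N − (s / (2 · fLevy2 11)) N^{2/3}`, with the certified constants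
`2π / fLevy2 11 > 1.6732` (no isolated ball) and `3/2` (isolated balls allowed), and `× 1.2217` under the Kepler
volume factor (`1.2217 < (π/√18)^{-2/3}`, certified from `π < 3.1416`). The two IFs are hypotheses about the
given packing — the geometric/measure-theoretic derivation of them from the cited inequalities is NOT formalised
here. Nothing in this file is a crystallization statement.

Also recorded (rung 2 of `DECOMPOSITION.md` §5): with the spherical isodiametric inequality
(Böröczky–Sagmeister 2020, Thm 1.2) the `k = 11` row improves to `fIso11 = 8π(1 − √3/2)` and the constant
becomes the closed form `2π / fIso11 = 1 + √3/2` (`two_pi_div_fIso11`), binding type still `k = 11` when balls with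
one contact are excluded (`fLevy2_le_fIso11_mul`).
-/

noncomputable section

open Real Finset
open scoped BigOperators

namespace Summit.Ventures.Crystal3D.Inequalities

/-! ### 1. The summation with isolated balls allowed (type `k = 0`, `f 0 = 16π`) -/

/-- **Summation, all types `0 ≤ k ≤ 12`.** If `e i ≤ f (k i)`, `f 12 ≤ 0`, `f m ≤ ρ (12 − m)` for all `m ≤ 11`,
and `S ≤ ∑ e i`, then `∑ k i ≤ 12 n − S/ρ`. [folklore] -/
theorem sum_deg_le_of_exposed₀ {n : ℕ} (k : Fin n → ℕ) (e : Fin n → ℝ) (f : ℕ → ℝ) {ρ S : ℝ}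
    (hρ : 0 < ρ) (hk12 : ∀ i, k i ≤ 12) (hf12 : f 12 ≤ 0)
    (hf : ∀ m, m ≤ 11 → f m ≤ ρ * (12 - m)) (he : ∀ i, e i ≤ f (k i))
    (hS : S ≤ ∑ i, e i) :
    (∑ i, (k i : ℝ)) ≤ 12 * n - S / ρ := by
  have key : ∀ i, e i ≤ ρ * (12 - (k i : ℝ)) := by
    intro i
    rcases Nat.lt_or_ge (k i) 12 with hlt | hge
    · have := hf (k i) (by omega)
      exact (he i).trans (by exact_mod_cast this)
    · have h12 : k i = 12 := le_antisymm (hk12 i) hge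
      have : e i ≤ 0 := (he i).trans (by rw [h12]; exact hf12)
      rw [h12]; push_cast; linarith
  have hsum : S ≤ ρ * (12 * n - ∑ i, (k i : ℝ)) := by
    calc S ≤ ∑ i, e i := hS
      _ ≤ ∑ i, ρ * (12 - (k i : ℝ)) := sum_le_sum fun i _ => key i
      _ = ρ * (12 * n - ∑ i, (k i : ℝ)) := by
        rw [← mul_sum, sum_sub_distrib, sum_const, card_univ, Fintype.card_fin, nsmul_eq_mul]; ring
  have : S / ρ ≤ 12 * n - ∑ i, (k i : ℝ) := by
    rw [div_le_iff₀ hρ]; linarith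
  linarith

/-- `fLevy2 0 = 16π`. [folklore] -/
theorem fLevy2_zero : fLevy2 0 = 16 * π := by simp [fLevy2]

/-- **Rows with isolated balls**: `fLevy2 m ≤ (4π/3)(12 − m)` for all `m ≤ 11` (type `0` binds: `16π = (4π/3)·12`;
for `1 ≤ m ≤ 11`, `fLevy2 m ≤ fLevy2 11 (12 − m)` and `fLevy2 11 = 8π g₁₁ < 8π · 0.149409 < 4π/3`). [folklore] -/
theorem fLevy2_le_four_pi_div_three_mul (m : ℕ) (hm : m ≤ 11) :
    fLevy2 m ≤ 4 * π / 3 * (12 - (m : ℝ)) := by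
  have hπ : 0 < π := pi_pos
  rcases Nat.eq_zero_or_pos m with rfl | hm1
  · rw [fLevy2_zero]; push_cast; linarith
  · have h := fLevy2_le m hm1 hm
    have hg := g_eleven_bounds.2
    have hf11 : fLevy2 11 = 8 * π * g 11 := by simp [fLevy2]
    have h12m : (0 : ℝ) ≤ 12 - (m : ℝ) := by
      have : (m : ℝ) ≤ 11 := by exact_mod_cast hm
      linarith
    calc fLevy2 m ≤ fLevy2 11 * (12 - (m : ℝ)) := h
      _ ≤ 4 * π / 3 * (12 - (m : ℝ)) := by
        apply mul_le_mul_of_nonneg_right _ h12m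
        rw [hf11]; nlinarith

/-! ### 2. Bridge theorems for unit packings (`IsUnitPacking`, `coordination`, `numContacts`) -/

variable {N : ℕ} {x : Fin N → EuclideanSpace ℝ (Fin 3)}

/-- **Exposed area ⇒ contacts (general resource constant `s`, no isolated ball).** For a unit packing `x` in
`ℝ³` in which every ball has a contact, per-ball quantities `e i ≤ fLevy2 (coordination x i)` with
`s · N^{2/3} ≤ ∑ e i` force `numContacts x ≤ 6N − (s / (2 fLevy2 11)) N^{2/3}`. [folklore] -/
theorem numContacts_le_of_exposed (hx : IsUnitPacking x) (hk1 : ∀ i, 1 ≤ coordination x i)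
    (e : Fin N → ℝ) {s : ℝ} (he : ∀ i, e i ≤ fLevy2 (coordination x i))
    (hS : s * (N : ℝ) ^ ((2 : ℝ) / 3) ≤ ∑ i, e i) :
    (numContacts x : ℝ) ≤ 6 * N - s / (2 * fLevy2 11) * (N : ℝ) ^ ((2 : ℝ) / 3) :=
  contacts_le_of_levy2 (coordination x) e hk1 (coordination_le_twelve hx) he hS
    (sum_coordination_eq x).symm

/-- **Theorem A (arithmetic form) for unit packings**: with the elementary resource bound `∑ e i ≥ 4π N^{2/3}`
(`dv = 1`: every truncated Voronoi cell contains its unit ball) and no isolated ball,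
`numContacts x ≤ 6N − 1.6732 N^{2/3}`. [folklore] -/
theorem numContacts_le_levyA (hx : IsUnitPacking x) (hk1 : ∀ i, 1 ≤ coordination x i)
    (e : Fin N → ℝ) (he : ∀ i, e i ≤ fLevy2 (coordination x i))
    (hS : 4 * π * (N : ℝ) ^ ((2 : ℝ) / 3) ≤ ∑ i, e i) :
    (numContacts x : ℝ) ≤ 6 * N - 1.6732 * (N : ℝ) ^ ((2 : ℝ) / 3) :=
  contacts_le_levyA (coordination x) e hk1 (coordination_le_twelve hx) he hS (sum_coordination_eq x).symm

/-- **Isolated balls allowed: the constant `3/2` exactly.** Without the hypothesis `hk1` the type `k = 0`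
(`fLevy2 0 = 16π`, deficit `12`) binds, `ρ = 4π/3`, and `∑ e i ≥ 4π N^{2/3}` gives
`numContacts x ≤ 6N − (3/2) N^{2/3}`. [folklore] -/
theorem numContacts_le_levy₀ (hx : IsUnitPacking x)
    (e : Fin N → ℝ) (he : ∀ i, e i ≤ fLevy2 (coordination x i))
    (hS : 4 * π * (N : ℝ) ^ ((2 : ℝ) / 3) ≤ ∑ i, e i) :
    (numContacts x : ℝ) ≤ 6 * N - 3 / 2 * (N : ℝ) ^ ((2 : ℝ) / 3) := by
  have hπ : 0 < π := pi_pos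
  have h := sum_deg_le_of_exposed₀ (coordination x) e fLevy2 (ρ := 4 * π / 3) (by positivity)
    (coordination_le_twelve hx) (le_of_eq fLevy2_twelve) fLevy2_le_four_pi_div_three_mul he hS
  have hC : ((2 * numContacts x : ℕ) : ℝ) = ∑ i, (coordination x i : ℝ) := by
    rw [← sum_coordination_eq x]; push_cast; rfl
  push_cast at hC
  have : 4 * π * (N : ℝ) ^ ((2 : ℝ) / 3) / (4 * π / 3) = 3 * (N : ℝ) ^ ((2 : ℝ) / 3) := by
    field_simp
  rw [this] at h
  linarith

/-- **Kepler factor certificate**: `1.2217 < (π/√18)^{-2/3}`, in the polynomial form `1.2217³ · π² < 18`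
(from `π < 3.1416`). [folklore] -/
theorem kepler_factor : (1.2217 : ℝ) ^ 3 * π ^ 2 < 18 := by
  have h := Real.pi_lt_d4
  have h0 : 0 < π := pi_pos
  nlinarith

/-- **Theorem B′ (arithmetic form)**: if the resource bound carries a factor `t ≥ 1.2217` (e.g. the Kepler
density via Bezdek's 2002 union lemma: `∑ e i ≥ 4π (π/√18)^{-2/3} N^{2/3}`), then
`numContacts x ≤ 6N − 2.044 N^{2/3}`. [folklore] -/
theorem numContacts_le_levyB (hx : IsUnitPacking x) (hk1 : ∀ i, 1 ≤ coordination x i)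
    (e : Fin N → ℝ) (he : ∀ i, e i ≤ fLevy2 (coordination x i)) {t : ℝ} (ht : 1.2217 ≤ t)
    (hS : 4 * π * t * (N : ℝ) ^ ((2 : ℝ) / 3) ≤ ∑ i, e i) :
    (numContacts x : ℝ) ≤ 6 * N - 2.044 * (N : ℝ) ^ ((2 : ℝ) / 3) := by
  have h := numContacts_le_of_exposed hx hk1 e he hS
  have hγ := gamma_gt
  have hf := fLevy2_eleven_pos
  have hn : 0 ≤ (N : ℝ) ^ ((2 : ℝ) / 3) := by positivity
  have heq : 4 * π * t / (2 * fLevy2 11) = t * (2 * π / fLevy2 11) := by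
    field_simp; ring
  rw [heq] at h
  have h2 : 2.044 ≤ t * (2 * π / fLevy2 11) := by nlinarith
  nlinarith

/-! ### 3. Rung 2: the isodiametric row for `k = 11` and the closed-form constant `1 + √3/2` -/

/-- `fIso11 := 8π (1 − √3/2) = 4 · cap(π/6)`: the exposed-area bound for an 11-contact ball at `r̂ = 2` from the
kissing number (the free region has spherical diameter `< π/3`) and the spherical isodiametric inequality
(Böröczky–Sagmeister 2020, Thm 1.2). [folklore] -/
def fIso11 : ℝ := 8 * π * (1 - sqrt 3 / 2)

/-- `0 < fIso11`. [folklore] -/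
theorem fIso11_pos : 0 < fIso11 := by
  have := sqrt_three_bounds.2
  have hπ : 0 < π := pi_pos
  unfold fIso11; nlinarith

/-- **The closed form**: `2π / fIso11 = 1 + √3/2` (since `(4 − 2√3)(1 + √3/2) = 1`). [folklore] -/
theorem two_pi_div_fIso11 : 2 * π / fIso11 = 1 + sqrt 3 / 2 := by
  have hπ : 0 < π := pi_pos
  have h3 : sqrt 3 ^ 2 = 3 := sq_sqrt (by norm_num)
  have hne : (1 - sqrt 3 / 2) ≠ 0 := by
    have := sqrt_three_bounds.2; intro h; nlinarith
  unfold fIso11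
  rw [div_eq_iff (by positivity)]
  nlinarith [h3]

/-- `fIso11 < fLevy2 11` (`3.3672 < 3.7550`): the isodiametric row is sharper. [folklore] -/
theorem fIso11_lt_fLevy2_eleven : fIso11 < fLevy2 11 := by
  have hπ : 0 < π := pi_pos
  obtain ⟨h3l, h3u⟩ := sqrt_three_bounds
  have hg := g_eleven_bounds.1
  have hf11 : fLevy2 11 = 8 * π * g 11 := by simp [fLevy2]
  rw [hf11]; unfold fIso11
  nlinarith

/-- **Rung-2 rows**: `fLevy2 m ≤ (12 − m) · fIso11` for `2 ≤ m ≤ 10` (i.e. `g_m ≤ (12 − m)(1 − √3/2)`; the row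
`m = 1` FAILS: `g₁ = 3/2 > 11 (1 − √3/2)`, which is why balls with one contact must be excluded). [folklore] -/
theorem fLevy2_le_fIso11_mul (m : ℕ) (hm2 : 2 ≤ m) (hm10 : m ≤ 10) :
    fLevy2 m ≤ (12 - (m : ℝ)) * fIso11 := by
  have hπ : 0 < π := pi_pos
  obtain ⟨h3l, h3u⟩ := sqrt_three_bounds
  have hm0 : m ≠ 0 := by omega
  have hm12 : ¬ 12 ≤ m := by omega
  simp only [fLevy2, hm0, hm12, if_false]
  unfold fIso11
  interval_cases m
  · have := g_two_le; push_cast; nlinarith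
  · have := g_three_le; push_cast; nlinarith
  · have := g_four_le; push_cast; nlinarith
  · have := g_five_le; push_cast; nlinarith
  · have := g_six_le; push_cast; nlinarith
  · have := g_seven_le; push_cast; nlinarith
  · have := g_eight_le; push_cast; nlinarith
  · have := g_nine_le; push_cast; nlinarith
  · have := g_ten_le; push_cast; nlinarith

/-- The rung-2 table: `fLevy2` with the `k = 11` entry replaced by `fIso11`. [folklore] -/
def fRung2 (k : ℕ) : ℝ := if k = 11 then fIso11 else fLevy2 k

/-- **Theorem A′ (arithmetic form)**: for a unit packing in `ℝ³` in which every ball has at least two contacts,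
per-ball quantities `e i ≤ fRung2 (coordination x i)` with `∑ e i ≥ 4π N^{2/3}` force
`numContacts x ≤ 6N − (1 + √3/2) N^{2/3}`. [folklore] -/
theorem numContacts_le_rung2 (hx : IsUnitPacking x) (hk2 : ∀ i, 2 ≤ coordination x i)
    (e : Fin N → ℝ) (he : ∀ i, e i ≤ fRung2 (coordination x i))
    (hS : 4 * π * (N : ℝ) ^ ((2 : ℝ) / 3) ≤ ∑ i, e i) :
    (numContacts x : ℝ) ≤ 6 * N - (1 + sqrt 3 / 2) * (N : ℝ) ^ ((2 : ℝ) / 3) := by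
  have hπ : 0 < π := pi_pos
  -- the LP rows for the rung-2 table with ρ = fIso11, on types 2..11 (type 1 excluded by hk2)
  have hrows : ∀ m, 1 ≤ m → m ≤ 11 → (fun m => if m = 1 then 0 else fRung2 m) m ≤ fIso11 * (12 - (m : ℝ)) := by
    intro m hm1 hm11
    by_cases h1 : m = 1
    · subst h1; simp; have := fIso11_pos; nlinarith
    · simp only [h1, if_false, fRung2]
      by_cases h11 : m = 11
      · subst h11; norm_num
      · simp only [h11, if_false]
        have := fLevy2_le_fIso11_mul m (by omega) (by omega)
        linarith
  have he' : ∀ i, e i ≤ (fun m => if m = 1 then (0 : ℝ) else fRung2 m) (coordination x i) := by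
    intro i
    have h2 := hk2 i
    have : coordination x i ≠ 1 := by omega
    simp only [this, if_false]
    exact he i
  have h12 : (fun m => if m = 1 then (0 : ℝ) else fRung2 m) 12 ≤ 0 := by
    simp [fRung2, fLevy2]
  have h := contacts_le_of_exposed (coordination x) e (fun m => if m = 1 then (0 : ℝ) else fRung2 m)
    fIso11_pos (fun i => le_trans (by norm_num) (hk2 i)) (coordination_le_twelve hx) h12 hrows he' hS
    (sum_coordination_eq x).symm
  have heq : 4 * π * (N : ℝ) ^ ((2 : ℝ) / 3) / (2 * fIso11) = (2 * π / fIso11) * (N : ℝ) ^ ((2 : ℝ) / 3) := by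
    field_simp; ring
  rw [heq, two_pi_div_fIso11] at h
  exact h

end Summit.Ventures.Crystal3D.Inequalities

end
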